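import Mathlib
import Literature.NumberTheory.LFunctions.Zhang2022.TypedSection10B
import Literature.NumberTheory.LFunctions.Zhang2022.Section8ChangeOfVariables
import Literature.NumberTheory.LFunctions.Zhang2022.Section10Theta1Evals
import Literature.NumberTheory.LFunctions.Zhang2022.TypedSection01and02B
import Literature.NumberTheory.LFunctions.Zhang2022.TypedSection12A
import HarnessLib

/-!
# Zhang (2022) §10: the profiles `𝔣_{jμ}(Pʷ)` at the ACTUAL shifts (2.13) versus the printed
# `𝔣𝔣_{jμ}(w)`, and the substitution node `Z22:§10.u036` (third line) = `Typed.Sec10B.Eq1036c`, DISCHARGED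

Topic `Literature/NumberTheory/LFunctions/Zhang2022` (Landau–Siegel audit tree; verdict-neutral).
Y. Zhang, *Discrete mean estimates and the Landau–Siegel zero*, arXiv:2211.02515v1 (2022)
[Zhang2022LandauSiegel], §8 p. 47 ((8.13)–(8.18), "`𝔣_{jμ}(Pᶻ) = 𝔣𝔣_{jμ}(z) + O(𝓛⁻⁸)`") and §10
p. 57 (the evaluation of `Θ₁(𝐚₁₁,𝐚₁₃)`, node u036) — **an unrefereed manuscript under
adjudication**; nothing here asserts or denies its Theorems 1–2, and nothing here is about
Landau–Siegel zeros. Campaign D-0069, discharge lane (layer L3, seat d31; LEDGER #7 grant Eq1036c).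

What is PROVED here (theorems only, unconditional; the statement `Eq1036c` is L3-t2's, cited by name):

* `norm_frakfW_exp_sub_ffSel_le` — **the shift lemma**: for `j ∈ {1,2,3}`, `μ ∈ {6,7}`, every real
  `w` and every `c′`, with the ACTUAL shifts `β₁ = iα(1 − 5c′α𝓛)`, `β₂ = 2iα(1 + c′α𝓛)`,
  `β₃ = 3iα(1 − c′α𝓛)` (2.13), `β₆ = 3iα/2`, `β₇ = 5iα/2` (2.22) and `α log P = π`:
  `‖𝔣_{jμ}(Pʷ) − 𝔣𝔣_{jμ}(w)‖ ≤ 5π|c′|α𝓛|w|` (`𝔣_{jμ} = Skeleton.frakfW`, `𝔣𝔣_{jμ} = Typed.Sec10B.ffSel`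
  = the tree's `ff16 … ff37`); in fact `𝔣_{jμ}(Pʷ) − 𝔣𝔣_{jμ}(w) = κ_j c′α𝓛 · πiw · e^{k_μπiw}` exactly,
  `κ = (5, −2, 3)` (`frakf_sub_ffF`). This is the printed `O(𝓛⁻⁸)` made explicit (`α𝓛 = π𝓛⁻⁸`), and is
  the input of every "`∫dx/x → ∫dz`" passage of §10 (u036–u038, u043–u044, u049–u050, u055–u057).
* `eq1036c_holds : ∀ c′, Eq1036c c′` — **node `Z22:§10.u036`, third line**: "`(𝔞β_{j+1}β_{j+2}/500)
  ∫₁^{P^{0.5}}(𝔣_{j6}(P^{0.504}/x)/0.504 + ι₂𝔣_{j7}(P^{0.5}/x)/0.5)dx/x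
  = (𝔞β_{j+1}β_{j+2}log P/500)∫₀^{0.5}(𝔣𝔣_{j6}(0.004+z)/0.504 + ι₂𝔣𝔣_{j7}(z)/0.5)dz + o(α)`" (p. 57,
  tex L2905–L2911): substitution `x = P^{0.5−z}` (the tree's `integral_one_Ppow`), reflection
  `z ↦ 0.5 − z`, the shift lemma, `|β_{j+1}β_{j+2}| ≤ 36α²` (`norm_betaJ_le`, valid once `|c′|α𝓛 ≤ 1`),
  `‖ι₂‖ ≤ 3`, and `𝔞 ≤ 16e⁹𝓛⁴` (the tree's `Skeleton.frakA_le_ell_pow_four'`), giving the error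
  `≤ K|c′|𝓛⁻⁴·α ≤ εα` for `log D ≥ M(ε, c′)` (explicit `D₀ = ⌈exp M⌉`). Assumption (A) is not used.
* bookkeeping: `logP_eq` (`log P = 𝓛⁹`), `alpha_mul_logP` (`α log P = π`, `D ≥ 2`), `norm_iota2_le`,
  `continuous_ffSel`, `continuous_frakfW_exp` (the tree's `Section2.alpha_eq_pi_div_ell9` and
  `Typed.Sec12A.ell_pos` are reused, not restated).

## References

* Y. Zhang, arXiv:2211.02515v1 (2022), §2 (2.10), (2.13), (2.22), (2.26), (2.31); §8 p. 47;
  §10 p. 57. [cite: Zhang2022LandauSiegel, §10 p. 57]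
-/


noncomputable section

open Complex Real ComplexConjugate MeasureTheory
open Literature.NumberTheory.LFunctions.Zhang2022.Skeleton

namespace Literature.NumberTheory.LFunctions.Zhang2022.Typed.Sec10B

/-! ## Parameter bookkeeping -/

/-- `log P = 𝓛⁹`. [cite: Zhang2022LandauSiegel, §2 (2.6)] -/
theorem logP_eq (D : ℕ) : logP D = ell D ^ 9 := by
  rw [logP, bigP, Real.log_exp]

/-- `α · log P = π` once `D ≥ 2` (so that `log P = 𝓛⁹ > 0`). [cite: Zhang2022LandauSiegel, §2 (2.10)] -/
theorem alpha_mul_logP {D : ℕ} (hD : 2 ≤ D) : alpha D * logP D = π := by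
  have hL : 0 < logP D := by rw [logP_eq]; exact pow_pos (Typed.Sec12A.ell_pos hD) 9
  rw [alpha, ← logP]
  field_simp

/-- `‖r · πiw · e^{kπiw}‖ = |r|π|w|` for real `r, w` and rational `k`. [folklore] -/
private theorem norm_err_term (r : ℝ) (k : ℚ) (w : ℝ) :
    ‖(r : ℂ) * (π * I * w) * cexp ((k : ℂ) * π * I * w)‖ = |r| * π * |w| := by
  have hE : ‖cexp ((k : ℂ) * π * I * w)‖ = 1 := by
    rw [show ((k : ℂ) * π * I * w) = ((k * π * w : ℝ) : ℂ) * I by push_cast; ring,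
      Complex.norm_exp_ofReal_mul_I]
  rw [norm_mul, norm_mul, hE, mul_one, Complex.norm_real, Real.norm_eq_abs]
  rw [show (π : ℂ) * I * w = ((π * w : ℝ) : ℂ) * I by push_cast; ring, norm_mul, Complex.norm_I,
    mul_one, Complex.norm_real, Real.norm_eq_abs, abs_mul, abs_of_pos Real.pi_pos]
  ring

/-- The algebra behind every case: if `β_μ X = kπiw` then
`𝔣(β_j, β_μ; X) − 𝔣𝔣_{a,k}(w) = ((β_μ − β_j)X − aπiw)e^{kπiw}`. [cite: Zhang2022LandauSiegel, §8 (8.13)–(8.18)] -/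
theorem frakf_sub_ffF (βj βμ X : ℂ) (a k : ℚ) (w : ℝ) (hexp : βμ * X = (k : ℂ) * π * I * w) :
    frakf βj βμ X - ffF a k w = ((βμ - βj) * X - a * π * I * w) * cexp ((k : ℂ) * π * I * w) := by
  unfold frakf ffF
  rw [hexp]
  ring

/-! ## The shift identities: `𝔣_{jμ}(Pʷ) − 𝔣𝔣_{jμ}(w) = κ_j c′α𝓛 · πiw · e^{k_μπiw}` -/

section Shift

variable (c' : ℝ) {D : ℕ}

/-- **`𝔣_{jμ}(Pʷ)` at the actual shifts versus the printed profile**, `j ∈ {1,2,3}`, `μ ∈ {6,7}`: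
with `β₁ = iα(1 − 5c′α𝓛)`, `β₂ = 2iα(1 + c′α𝓛)`, `β₃ = 3iα(1 − c′α𝓛)` (2.13), `β₆ = 3iα/2`,
`β₇ = 5iα/2` (2.22) and `α log P = π`,
`𝔣_{jμ}(Pʷ) = (1 + (β_μ − β_j)w log P)P^{wβ_μ} = 𝔣𝔣_{jμ}(w) + κ_j c′α𝓛 · πiw · e^{k_μπiw}`,
`κ = (5, −2, 3)`, hence **`‖𝔣_{jμ}(Pʷ) − 𝔣𝔣_{jμ}(w)‖ ≤ 5π|c′|α𝓛|w|`** for every real `w` — the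
`O(𝓛⁻⁸)` of "𝔣_{jμ}(Pᶻ) = 𝔣𝔣_{jμ}(z) + O(𝓛⁻⁸)" (§8 p. 47, §10 p. 57) made explicit (`α𝓛 = π𝓛⁻⁸`).
[cite: Zhang2022LandauSiegel, §8 (8.13)–(8.18) p. 47; §10 p. 57] -/
theorem norm_frakfW_exp_sub_ffSel_le (hD : 2 ≤ D) {j : ℕ} (hj : j ∈ ({1, 2, 3} : Finset ℕ))
    {μ : ℕ} (hμ : μ ∈ ({6, 7} : Finset ℕ)) (w : ℝ) :
    ‖frakfW c' D j μ (rexp (logP D * w)) - ffSel j μ w‖ ≤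
      5 * π * |c'| * (alpha D * ell D) * |w| := by
  have hπ : (π : ℂ) = (alpha D : ℂ) * (logP D : ℂ) := by
    rw [← Complex.ofReal_mul, alpha_mul_logP hD]
  have hA : 0 ≤ alpha D := by
    rw [Section2.alpha_eq_pi_div_ell9]
    exact div_nonneg Real.pi_pos.le (pow_nonneg (Real.log_natCast_nonneg D) 9)
  have hℓ : 0 ≤ ell D := Real.log_natCast_nonneg D
  -- the bound from an identity `diff = (r : ℂ) * (π I w) * cexp (k π I w)` with `|r| ≤ 5|c'|αℓ`
  have finish : ∀ (r : ℝ) (k : ℚ), |r| ≤ 5 * |c'| * (alpha D * ell D) →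
      ∀ z : ℂ, z = (r : ℂ) * (π * I * w) * cexp ((k : ℂ) * π * I * w) →
        ‖z‖ ≤ 5 * π * |c'| * (alpha D * ell D) * |w| := by
    intro r k hr z hz
    rw [hz, norm_err_term]
    have hw : 0 ≤ π * |w| := mul_nonneg Real.pi_pos.le (abs_nonneg w)
    nlinarith
  have habs : ∀ κ : ℝ, |κ| ≤ 5 → |κ * c' * alpha D * ell D| ≤ 5 * |c'| * (alpha D * ell D) := by
    intro κ hκ
    rw [abs_mul, abs_mul, abs_mul, abs_of_nonneg hA, abs_of_nonneg hℓ]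
    have : 0 ≤ |c'| * (alpha D * ell D) := by positivity
    nlinarith [abs_nonneg c']
  simp only [Finset.mem_insert, Finset.mem_singleton] at hj hμ
  rw [frakfW, Real.log_exp]
  set X : ℂ := ((logP D * w : ℝ) : ℂ) with hX
  rcases hj with rfl | rfl | rfl <;> rcases hμ with rfl | rfl
  · -- j = 1, μ = 6 : κ = 5, a = 1/2, k = 3/2
    have hsel : ffSel 1 6 w = ffF (1/2) (3/2) w := by norm_num [ffSel, ff16]
    have hJ : betaJ c' D 1 = beta1 c' D := by norm_num [betaJ]
    have hM : betaMu D 6 = beta6 D := by norm_num [betaMu]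
    have hexp : beta6 D * X = (((3:ℚ)/2 : ℚ) : ℂ) * π * I * w := by
      rw [beta6, hX, hπ]; push_cast; ring
    refine finish (5 * c' * alpha D * ell D) ((3:ℚ)/2) (habs 5 (by norm_num)) _ ?_
    rw [hsel, hJ, hM, frakf_sub_ffF _ _ _ _ _ _ hexp, beta6, beta1, hX, hπ]
    push_cast; ring
  · -- j = 1, μ = 7 : κ = 5, a = 3/2, k = 5/2
    have hsel : ffSel 1 7 w = ffF (3/2) (5/2) w := by norm_num [ffSel, ff17]
    have hJ : betaJ c' D 1 = beta1 c' D := by norm_num [betaJ]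
    have hM : betaMu D 7 = beta7 D := by norm_num [betaMu]
    have hexp : beta7 D * X = (((5:ℚ)/2 : ℚ) : ℂ) * π * I * w := by
      rw [beta7, hX, hπ]; push_cast; ring
    refine finish (5 * c' * alpha D * ell D) ((5:ℚ)/2) (habs 5 (by norm_num)) _ ?_
    rw [hsel, hJ, hM, frakf_sub_ffF _ _ _ _ _ _ hexp, beta7, beta1, hX, hπ]
    push_cast; ring
  · -- j = 2, μ = 6 : κ = -2, a = -1/2, k = 3/2
    have hsel : ffSel 2 6 w = ffF (-1/2) (3/2) w := by norm_num [ffSel, ff26]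
    have hJ : betaJ c' D 2 = beta2 c' D := by norm_num [betaJ]
    have hM : betaMu D 6 = beta6 D := by norm_num [betaMu]
    have hexp : beta6 D * X = (((3:ℚ)/2 : ℚ) : ℂ) * π * I * w := by
      rw [beta6, hX, hπ]; push_cast; ring
    refine finish (-2 * c' * alpha D * ell D) ((3:ℚ)/2) (habs (-2) (by norm_num)) _ ?_
    rw [hsel, hJ, hM, frakf_sub_ffF _ _ _ _ _ _ hexp, beta6, beta2, hX, hπ]
    push_cast; ring
  · -- j = 2, μ = 7 : κ = -2, a = 1/2, k = 5/2
    have hsel : ffSel 2 7 w = ffF (1/2) (5/2) w := by norm_num [ffSel, ff27]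
    have hJ : betaJ c' D 2 = beta2 c' D := by norm_num [betaJ]
    have hM : betaMu D 7 = beta7 D := by norm_num [betaMu]
    have hexp : beta7 D * X = (((5:ℚ)/2 : ℚ) : ℂ) * π * I * w := by
      rw [beta7, hX, hπ]; push_cast; ring
    refine finish (-2 * c' * alpha D * ell D) ((5:ℚ)/2) (habs (-2) (by norm_num)) _ ?_
    rw [hsel, hJ, hM, frakf_sub_ffF _ _ _ _ _ _ hexp, beta7, beta2, hX, hπ]
    push_cast; ring
  · -- j = 3, μ = 6 : κ = 3, a = -3/2, k = 3/2
    have hsel : ffSel 3 6 w = ffF (-3/2) (3/2) w := by norm_num [ffSel, ff36]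
    have hJ : betaJ c' D 3 = beta3 c' D := by norm_num [betaJ]
    have hM : betaMu D 6 = beta6 D := by norm_num [betaMu]
    have hexp : beta6 D * X = (((3:ℚ)/2 : ℚ) : ℂ) * π * I * w := by
      rw [beta6, hX, hπ]; push_cast; ring
    refine finish (3 * c' * alpha D * ell D) ((3:ℚ)/2) (habs 3 (by norm_num)) _ ?_
    rw [hsel, hJ, hM, frakf_sub_ffF _ _ _ _ _ _ hexp, beta6, beta3, hX, hπ]
    push_cast; ring
  · -- j = 3, μ = 7 : κ = 3, a = -1/2, k = 5/2
    have hsel : ffSel 3 7 w = ffF (-1/2) (5/2) w := by norm_num [ffSel, ff37]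
    have hJ : betaJ c' D 3 = beta3 c' D := by norm_num [betaJ]
    have hM : betaMu D 7 = beta7 D := by norm_num [betaMu]
    have hexp : beta7 D * X = (((5:ℚ)/2 : ℚ) : ℂ) * π * I * w := by
      rw [beta7, hX, hπ]; push_cast; ring
    refine finish (3 * c' * alpha D * ell D) ((5:ℚ)/2) (habs 3 (by norm_num)) _ ?_
    rw [hsel, hJ, hM, frakf_sub_ffF _ _ _ _ _ _ hexp, beta7, beta3, hX, hπ]
    push_cast; ring

end Shift

/-! ## Small facts used in the assembly -/

/-- `‖ι₂‖ ≤ 3` (`ι₂ = 0.94977 − 1.38995i`, (2.26)). [cite: Zhang2022LandauSiegel, §2 (2.26)] -/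
theorem norm_iota2_le : ‖iota2‖ ≤ 3 := by
  refine (Complex.norm_le_abs_re_add_abs_im _).trans ?_
  rw [iota2]
  norm_num

/-- The shifts are `≤ 6α` in modulus once `|c′|α𝓛 ≤ 1`: `|β₁| = α|1 − 5c′α𝓛| ≤ 6α`, `|β₂| ≤ 4α`,
`|β₃| ≤ 6α` ((2.13); `β₄ = β₁`, `β₅ = β₂`). [cite: Zhang2022LandauSiegel, §2 (2.13)] -/
theorem norm_betaJ_le (c' : ℝ) {D : ℕ} (hc : |c'| * (alpha D * ell D) ≤ 1) (i : ℕ) :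
    ‖betaJ c' D i‖ ≤ 6 * alpha D := by
  have hA : 0 ≤ alpha D := by
    rw [Section2.alpha_eq_pi_div_ell9]
    exact div_nonneg Real.pi_pos.le (pow_nonneg (Real.log_natCast_nonneg D) 9)
  have hℓ : 0 ≤ ell D := Real.log_natCast_nonneg D
  have hcAℓ : |c' * alpha D * ell D| ≤ 1 := by
    rw [abs_mul, abs_mul, abs_of_nonneg hA, abs_of_nonneg hℓ]; linarith
  have key : ∀ (n : ℝ) (t : ℝ), 0 ≤ n → n * (1 + |t|) ≤ 6 →
      ‖(n : ℂ) * I * (alpha D : ℂ) * ((1 + t * (c' * alpha D * ell D) : ℝ) : ℂ)‖ ≤ 6 * alpha D := by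
    intro n t hn0 hnt
    rw [norm_mul, norm_mul, norm_mul, Complex.norm_real, Complex.norm_I, Complex.norm_real,
      Complex.norm_real, Real.norm_of_nonneg hn0, Real.norm_of_nonneg hA, mul_one, Real.norm_eq_abs]
    have h1 : |1 + t * (c' * alpha D * ell D)| ≤ 1 + |t| := by
      refine (abs_add_le _ _).trans ?_
      rw [abs_one, abs_mul]
      have : |t| * |c' * alpha D * ell D| ≤ |t| * 1 := by gcongr
      linarith
    calc n * alpha D * |1 + t * (c' * alpha D * ell D)| ≤ n * alpha D * (1 + |t|) := by gcongr
      _ = n * (1 + |t|) * alpha D := by ring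
      _ ≤ 6 * alpha D := by gcongr
  unfold betaJ
  split_ifs
  · -- β₁ = iα(1 − 5c′α𝓛)
    have h := key 1 (-5) (by norm_num) (by norm_num)
    rw [beta1]
    convert h using 3 <;> push_cast <;> ring
  · have h := key 2 1 (by norm_num) (by norm_num)
    rw [beta2]
    convert h using 3 <;> push_cast <;> ring
  · have h := key 3 (-1) (by norm_num) (by norm_num)
    rw [beta3]
    convert h using 3 <;> push_cast <;> ring

/-- `𝔣𝔣_{jμ}` (any selector values) is continuous. [cite: Zhang2022LandauSiegel, §8 (8.13)–(8.18)] -/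
theorem continuous_ffSel (j μ : ℕ) : Continuous (ffSel j μ) := by
  unfold ffSel
  split_ifs
  exacts [continuous_ff17, continuous_ff27, continuous_ff37, continuous_ff16, continuous_ff26,
    continuous_ff36]

/-- `u ↦ 𝔣_{jμ}(e^{a + bu})` is continuous (the `z`-integrands of §10 after `x = Pᶻ`).
[cite: Zhang2022LandauSiegel, §10 p. 57] -/
theorem continuous_frakfW_exp (c' : ℝ) (D : ℕ) (j μ : ℕ) (a b : ℝ) :
    Continuous fun u : ℝ => frakfW c' D j μ (rexp (a + b * u)) := by
  have h : (fun u : ℝ => frakfW c' D j μ (rexp (a + b * u))) =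
      fun u : ℝ => frakf (betaJ c' D j) (betaMu D μ) (((a + b * u : ℝ)) : ℂ) := by
    funext u; rw [frakfW, Real.log_exp]
  rw [h]
  unfold frakf
  fun_prop

/-! ## `Z22:§10.u036`, third line: the substitution `x = P^{0.5−z}` -/

/-- `Z22:§10.u036` (third line) DISCHARGED: **"`(𝔞β_{j+1}β_{j+2}/500)∫₁^{P^{0.5}}(𝔣_{j6}(P^{0.504}/x)/0.504
+ ι₂𝔣_{j7}(P^{0.5}/x)/0.5)dx/x = (𝔞β_{j+1}β_{j+2}log P/500)∫₀^{0.5}(𝔣𝔣_{j6}(0.004+z)/0.504 + ι₂𝔣𝔣_{j7}(z)/0.5)dz + o(α)`"**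
(Z22 p. 57, tex L2905–L2911), i.e. `Typed.Sec10B.Eq1036c c′`, for EVERY `c′`: the substitution
`x = P^{0.5−z}` (`dx/x = −log P dz`, the tree's `integral_one_Ppow`), the reflection `z ↦ 0.5 − z`,
the shift lemma `norm_frakfW_exp_sub_ffSel_le` (`𝔣_{jμ}(Pʷ) = 𝔣𝔣_{jμ}(w) + O(|c′|α𝓛)` at the
ACTUAL shifts (2.13)), `|β_{j+1}β_{j+2}| ≤ 36α²`, `α log P = π` and `𝔞 ≤ 16e⁹𝓛⁴`
(`frakA_le_ell_pow_four'`) give the error `≤ K|c′|𝔞·α·α𝓛 ≤ K′|c′|𝓛⁻⁴·α ≤ εα` for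
`𝓛 = log D ≥ M(ε, c′)`. Assumption (A) is not used. [cite: Zhang2022LandauSiegel, §10 p. 57 (u036)] -/
theorem eq1036c_holds (c' : ℝ) : Eq1036c c' := by
  intro ε hε
  -- the constant of the final bound and the threshold `M` on `𝓛 = log D`
  set K : ℝ := 16 * Real.exp 9 * 36 * (10 * π) / 500 * π ^ 2 with hK
  have hK0 : 0 ≤ K := by rw [hK]; positivity
  set M : ℝ := max 3 (max (4 * (1 + |c'|)) (K * (1 + |c'|) / ε + 1)) with hM
  have hM3 : 3 ≤ M := le_max_left _ _
  have hMc : 4 * (1 + |c'|) ≤ M := le_trans (le_max_left _ _) (le_max_right _ _)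
  have hMε : K * (1 + |c'|) / ε + 1 ≤ M := le_trans (le_max_right _ _) (le_max_right _ _)
  refine ⟨⌈Real.exp M⌉₊, fun D _ χ hD _ hprim _ j hj => ?_⟩
  -- `𝓛 ≥ M`
  have hDM : Real.exp M ≤ D := le_trans (Nat.le_ceil _) (by exact_mod_cast hD)
  have hD0 : (0 : ℝ) < D := lt_of_lt_of_le (Real.exp_pos M) hDM
  have hℓM : M ≤ ell D := by rw [ell, Real.le_log_iff_exp_le hD0]; exact hDM
  have hℓ3 : 3 ≤ ell D := hM3.trans hℓM
  have hℓ1 : 1 ≤ ell D := by linarith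
  have hℓpos : 0 < ell D := by linarith
  have hD2 : 2 ≤ D := by
    by_contra h
    push Not at h
    have : ell D < 3 := by
      rw [ell]
      interval_cases D
      · simp
      · rw [Nat.cast_one, Real.log_one]; norm_num
    linarith
  -- abbreviations
  set ℓ := ell D with hℓdef
  set A := alpha D with hAdef
  set L := logP D with hLdef
  have hLℓ : L = ℓ ^ 9 := logP_eq D
  have hAeq : A = π / ℓ ^ 9 := Section2.alpha_eq_pi_div_ell9 D
  have hLpos : 0 < L := by rw [hLℓ]; positivity
  have hApos : 0 < A := by rw [hAeq]; positivity
  have hAL : A * L = π := alpha_mul_logP hD2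
  have hAℓ : A * ℓ = π / ℓ ^ 8 := by
    rw [hAeq]; field_simp
  -- `|c'| α 𝓛 ≤ 1`
  have hcAℓ : |c'| * (A * ℓ) ≤ 1 := by
    rw [hAℓ]
    have h8 : ℓ ≤ ℓ ^ 8 := le_self_pow₀ hℓ1 (by norm_num)
    have h1 : π / ℓ ^ 8 ≤ π / ℓ := div_le_div_of_nonneg_left Real.pi_pos.le hℓpos h8
    have h2 : |c'| * (π / ℓ) ≤ |c'| * (π / (4 * (1 + |c'|))) := by
      gcongr
      exact hMc.trans hℓM
    have h3 : |c'| * (π / (4 * (1 + |c'|))) ≤ 1 := by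
      rw [← mul_div_assoc, div_le_one (by positivity)]
      nlinarith [Real.pi_lt_four, abs_nonneg c']
    calc |c'| * (π / ℓ ^ 8) ≤ |c'| * (π / ℓ) := by gcongr
      _ ≤ 1 := h2.trans h3
  -- the two `z`-integrands
  set F : ℝ → ℂ := fun u => frakfW c' D j 6 (rexp (L * (0.004 + u))) / 0.504 +
    iota2 * frakfW c' D j 7 (rexp (L * u)) / 0.5 with hF
  set G : ℝ → ℂ := fun u => ffSel j 6 (0.004 + u) / 0.504 + iota2 * ffSel j 7 u / 0.5 with hG
  have hFc : Continuous F := by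
    have h6 := continuous_frakfW_exp c' D j 6 (L * 0.004) L
    have h7 := continuous_frakfW_exp c' D j 7 0 L
    have e6 : (fun u : ℝ => frakfW c' D j 6 (rexp (L * (0.004 + u)))) =
        fun u : ℝ => frakfW c' D j 6 (rexp (L * 0.004 + L * u)) := by
      funext u; rw [mul_add]
    have e7 : (fun u : ℝ => frakfW c' D j 7 (rexp (L * u))) =
        fun u : ℝ => frakfW c' D j 7 (rexp (0 + L * u)) := by
      funext u; rw [zero_add]
    rw [hF]
    refine Continuous.add ?_ ?_
    · exact (e6 ▸ h6).div_const _
    · exact ((continuous_const.mul (e7 ▸ h7)).div_const _)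
  have hGc : Continuous G := by
    rw [hG]
    refine Continuous.add ?_ ?_
    · exact ((continuous_ffSel j 6).comp (continuous_const.add continuous_id)).div_const _
    · exact (continuous_const.mul (continuous_ffSel j 7)).div_const _
  -- Step 1: the substitution `x = P^{0.5 − z}`
  have hX : (∫ x in (1 : ℝ)..(bigP D ^ (0.5 : ℝ)),
      (frakfW c' D j 6 (bigP D ^ (0.504 : ℝ) / x) / 0.504 +
        iota2 * frakfW c' D j 7 (bigP D ^ (0.5 : ℝ) / x) / 0.5) / (x : ℂ)) =
      (L : ℂ) * ∫ u in (0 : ℝ)..0.5, F u := by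
    have hP5 : bigP D ^ (0.5 : ℝ) = Ppow L 0.5 := by
      rw [Ppow, hLℓ, hℓdef, bigP, ← Real.exp_mul]
    have hg : ∀ z : ℝ, frakfW c' D j 6 (bigP D ^ (0.504 : ℝ) / rexp (L * z)) / 0.504 +
        iota2 * frakfW c' D j 7 (bigP D ^ (0.5 : ℝ) / rexp (L * z)) / 0.5 = F (0.5 - z) := by
      intro z
      have e1 : bigP D ^ (0.504 : ℝ) / rexp (L * z) = rexp (L * (0.004 + (0.5 - z))) := by
        rw [bigP, ← Real.exp_mul, ← Real.exp_sub, hLℓ, hℓdef]; congr 1; ring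
      have e2 : bigP D ^ (0.5 : ℝ) / rexp (L * z) = rexp (L * (0.5 - z)) := by
        rw [bigP, ← Real.exp_mul, ← Real.exp_sub, hLℓ, hℓdef]; congr 1; ring
      rw [hF, e1, e2]
    have key : (∫ x in (1 : ℝ)..(bigP D ^ (0.5 : ℝ)),
        (frakfW c' D j 6 (bigP D ^ (0.504 : ℝ) / x) / 0.504 +
          iota2 * frakfW c' D j 7 (bigP D ^ (0.5 : ℝ) / x) / 0.5) / (x : ℂ)) =
        (L : ℂ) * ∫ z in (0 : ℝ)..0.5, (frakfW c' D j 6 (bigP D ^ (0.504 : ℝ) / rexp (L * z)) / 0.504 +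
          iota2 * frakfW c' D j 7 (bigP D ^ (0.5 : ℝ) / rexp (L * z)) / 0.5) := by
      have k := integral_one_Ppow hLpos.le (0.5 : ℝ) (fun x : ℝ =>
        frakfW c' D j 6 (bigP D ^ (0.504 : ℝ) / x) / 0.504 +
          iota2 * frakfW c' D j 7 (bigP D ^ (0.5 : ℝ) / x) / 0.5)
      rw [← hP5] at k
      simpa only using k
    rw [key, intervalIntegral.integral_congr (g := fun z => F (0.5 - z)) (fun z _ => hg z),
      intervalIntegral.integral_comp_sub_left (fun u => F u) (0.5 : ℝ)]
    norm_num
  -- Step 2: the two `z`-integrals differ by `O(|c'| α 𝓛)`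
  have hFG : ‖(∫ u in (0 : ℝ)..0.5, F u) - ∫ u in (0 : ℝ)..0.5, G u‖ ≤
      20 * π * |c'| * (A * ℓ) * |0.5 - 0| := by
    rw [← intervalIntegral.integral_sub (hFc.intervalIntegrable _ _) (hGc.intervalIntegrable _ _)]
    refine intervalIntegral.norm_integral_le_of_norm_le_const fun u hu => ?_
    rw [Set.uIoc_of_le (by norm_num : (0 : ℝ) ≤ 0.5)] at hu
    obtain ⟨hu0, hu1⟩ := hu
    have h6 := norm_frakfW_exp_sub_ffSel_le c' hD2 hj (μ := 6) (by simp) (0.004 + u)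
    have h7 := norm_frakfW_exp_sub_ffSel_le c' hD2 hj (μ := 7) (by simp) u
    have hw6 : |0.004 + u| ≤ 0.504 := by rw [abs_of_pos (by linarith)]; linarith
    have hw7 : |u| ≤ 0.5 := by rw [abs_of_pos hu0]; exact hu1
    have hnn : 0 ≤ 5 * π * |c'| * (A * ℓ) := by positivity
    have hdiff : F u - G u = (frakfW c' D j 6 (rexp (L * (0.004 + u))) - ffSel j 6 (0.004 + u)) / 0.504 +
        iota2 * (frakfW c' D j 7 (rexp (L * u)) - ffSel j 7 u) / 0.5 := by
      simp only [hF, hG]; ring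
    rw [hdiff]
    calc ‖(frakfW c' D j 6 (rexp (L * (0.004 + u))) - ffSel j 6 (0.004 + u)) / 0.504 +
          iota2 * (frakfW c' D j 7 (rexp (L * u)) - ffSel j 7 u) / 0.5‖
        ≤ ‖frakfW c' D j 6 (rexp (L * (0.004 + u))) - ffSel j 6 (0.004 + u)‖ / 0.504 +
          ‖iota2‖ * ‖frakfW c' D j 7 (rexp (L * u)) - ffSel j 7 u‖ / 0.5 := by
          refine (norm_add_le _ _).trans (le_of_eq ?_)
          rw [norm_div, norm_div, norm_mul]
          norm_num
      _ ≤ (5 * π * |c'| * (A * ℓ) * |0.004 + u|) / 0.504 +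
          3 * (5 * π * |c'| * (A * ℓ) * |u|) / 0.5 := by
          gcongr
          · exact norm_iota2_le
      _ ≤ (5 * π * |c'| * (A * ℓ) * 0.504) / 0.504 + 3 * (5 * π * |c'| * (A * ℓ) * 0.5) / 0.5 := by
          gcongr
      _ = 20 * π * |c'| * (A * ℓ) := by ring
  -- Step 3: sizes of the prefactors
  have hB : ‖betaJ c' D (j + 1) * betaJ c' D (j + 2)‖ ≤ 36 * A ^ 2 := by
    rw [norm_mul]
    have h1 := norm_betaJ_le c' hcAℓ (j + 1)
    have h2 := norm_betaJ_le c' hcAℓ (j + 2)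
    calc ‖betaJ c' D (j + 1)‖ * ‖betaJ c' D (j + 2)‖ ≤ (6 * A) * (6 * A) := by
          gcongr
      _ = 36 * A ^ 2 := by ring
  have h𝔞 : frakA χ ≤ 16 * Real.exp 9 * ℓ ^ 4 := frakA_le_ell_pow_four' χ hℓ3 hprim
  have h𝔞0 : 0 ≤ frakA χ := frakA_nonneg χ
  -- Step 4: assemble
  rw [hX]
  have hfact : (frakA χ : ℂ) * (betaJ c' D (j + 1) * betaJ c' D (j + 2)) / 500 *
        ((L : ℂ) * ∫ u in (0 : ℝ)..0.5, F u) -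
      (frakA χ : ℂ) * (betaJ c' D (j + 1) * betaJ c' D (j + 2)) * (L : ℂ) / 500 *
        (∫ u in (0 : ℝ)..0.5, G u) =
      (frakA χ : ℂ) * (betaJ c' D (j + 1) * betaJ c' D (j + 2)) * (L : ℂ) / 500 *
        ((∫ u in (0 : ℝ)..0.5, F u) - ∫ u in (0 : ℝ)..0.5, G u) := by ring
  rw [hfact, norm_mul, norm_div, norm_mul, norm_mul, Complex.norm_real, Complex.norm_real,
    Real.norm_of_nonneg h𝔞0, Real.norm_of_nonneg hLpos.le]
  have h500 : ‖(500 : ℂ)‖ = 500 := by norm_num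
  rw [h500]
  calc frakA χ * ‖betaJ c' D (j + 1) * betaJ c' D (j + 2)‖ * L / 500 *
        ‖(∫ u in (0 : ℝ)..0.5, F u) - ∫ u in (0 : ℝ)..0.5, G u‖
      ≤ (16 * Real.exp 9 * ℓ ^ 4) * (36 * A ^ 2) * L / 500 * (20 * π * |c'| * (A * ℓ) * |0.5 - 0|) := by
        gcongr
    _ = (K * |c'| / ℓ ^ 4) * A := by
        rw [hK, hAeq, hLℓ]
        norm_num
        field_simp
        ring
    _ ≤ ε * A := by
        gcongr
        rw [div_le_iff₀ (by positivity)]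
        have h4 : ℓ ≤ ℓ ^ 4 := le_self_pow₀ hℓ1 (by norm_num)
        have hK1 : K * (1 + |c'|) / ε + 1 ≤ ℓ := hMε.trans hℓM
        have hK2 : K * (1 + |c'|) ≤ ε * ℓ := by
          have := (div_le_iff₀ hε).mp (by linarith : K * (1 + |c'|) / ε ≤ ℓ)
          linarith
        nlinarith [abs_nonneg c', mul_nonneg hK0 (abs_nonneg c')]

variable (c' : ℝ) in
/-- `Eq1036c` — `_holds` alias of `eq1036c_holds` above under the fact's exact name, stated under the
prover's own binders as section variables (appended 2026-08-28, D-0026 bookkeeping: the proof term is the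
existing theorem of this file; no statement, definition or attribute is edited; no new named fact; the
ledger's debt table listed the fact unproved). [cite: Zhang2022LandauSiegel, §10 p. 57 (u036)] -/
theorem _root_.Literature.NumberTheory.LFunctions.Zhang2022.Typed.Sec10B.Eq1036c_holds :
    _root_.Literature.NumberTheory.LFunctions.Zhang2022.Typed.Sec10B.Eq1036c c' :=
  _root_.Literature.NumberTheory.LFunctions.Zhang2022.Typed.Sec10B.eq1036c_holds (c' := c')

end Literature.NumberTheory.LFunctions.Zhang2022.Typed.Sec10B
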